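import Literature.Analysis.FluidPDE.TaoCascadeRescaledEnergy
import Literature.Analysis.FluidPDE.TaoCascadeZeroScale
import Literature.Analysis.ODE.OneSidedComparison
import HarnessLib

/-!
# Tao's cascade ODE, proof of Prop. 6.5 — the scale-`1` energy in the rescaled past (for Prop. 6.13)

T. Tao, *Finite time blowup for an averaged three-dimensional Navier–Stokes equation*,
J. Amer. Math. Soc. 29 (2016), 601–674 (arXiv:1402.0290v3), §6.6, proof of Prop. 6.13
("Small `a₁` implies small `b₁, c₁, d₁`"), displays (6.120)–(6.125) of arXiv v3.

## What is proved, and why it deviates from the printed text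

The printed proof controls `c₁` on the whole rescaled past `[τ_{n₀-N}, 0]` by Gronwall's
inequality with the rate `(1+ε₀)^{5/2} ε⁻¹ K^{10} |b₁|`, under the bootstrap hypothesis (6.121)
`∫_{τ_{n₀-N}}^{τ'} |b₁| ≤ ε/10`, and closes the bootstrap with the decay
"`|b₁(t)| ≲ K^{-30} ε / (1+|t|²)` for `τ_{n₀-N} ≤ t ≤ 0`" read off from (6.120)
`Ẽ₁(t) ≲ K^{-30}/(1+|t|³)`. With the hypotheses (ix) of Prop. 6.5 as printed, the decay actually
available on the `k`-th past interval `[τ_{k-1}, τ_k]` is `Ẽ₁ ≤ K^{-30}(1+ε₀)^{(499/50)k}`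
(`RescaledHypotheses.energy_one_past_le`) against interval lengths `≲ C₃(1+ε₀)^{-(251/100)k}`; the
dissipative error `O((1+ε₀)^{-n₀/2} Ẽ₁^{1/2})` of the `b₁`-equation (6.46), integrated once, gives a
contribution to `|b₁|` of order `(1+ε₀)^{(499/100 - 251/100)k}` on the `k`-th interval, whose integral
over the past diverges like `∑_k (1+ε₀)^{-(3/100)k}` — i.e. it is *not* bounded uniformly in the
induction level `N` (the sum runs over `N - n₀` intervals), however small `(1+ε₀)^{-n₀/2}` is. The
bootstrap (6.121) therefore cannot be closed from (ix) alone.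

The repair proved here uses one more piece of the hypotheses, the local energy inequality (6.49)
at scale `1`: `∂ₜẼ₁ ≤ K(1+ε₀)^{5/2}(d₀²a₁ - (1+ε₀)^{5/2}d₁²a₂) ≤ 2α√Ẽ₁ + 2κẼ₁` with
`α = 6√2 K Ẽ₀`, `κ = 36√2 K Ẽ₂^{1/2}`, whence (square root of a supersolution, variable rate)
`Ẽ₁(t)^{1/2} ≤ e^{∫κ} · 6√2 K ∫_{τ_{n₀-N}}^t Ẽ₀`. Since `∫ Ẽ₂^{1/2}` over the past is `O(K^{-15} C₃)`
and `∫_{τ_{n₀-N}}^{τ_k} Ẽ₀ ≤ cumEnergyConst · (1+ε₀)^{(747/100)k}` (Lemma 6.7,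
`integral_energy_past_le`), this yields the **improved past decay**
`Ẽ₁(t)^{1/2} ≤ Ξ (1+ε₀)^{(747/100)k}` on `[τ_{k-1}, τ_k]` (`sqrt_energy_one_past_le_improved`), with
decay exponent `747/100 > 2·(251/100)`, which is what makes the two time-integrations of the
proof of Prop. 6.13 converge uniformly in `N` (file `TaoCascadeScaleOneSmall.lean`).

## Contents

* `sqrt_le_of_deriv_right_le_var` — `W' ≤ 2α√W + 2κ(t)W` ⟹ `√W(t) ≤ e^{∫κ}(√W(a) + ∫α)` (folklore;
  the constant-rate case is `sqrt_le_of_deriv_right_le` of `TaoCascadeZeroScale.lean`).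
* `RescaledHypotheses.exists_piece` — every past time lies in some `[τ_{k-1}, τ_k]`.
* `RescaledHypotheses.sqrt_energy_two_past_le`, `integral_sqrt_energy_two_past_le` — `Ẽ₂^{1/2}` on
  the past and its cumulative integral (from (ix)).
* `RescaledHypotheses.energy_one_deriv_le` — (6.49) at scale `1` as `∂ₜẼ₁ ≤ 2α√Ẽ₁ + 2κẼ₁`.
* `RescaledHypotheses.sqrt_energy_one_past_le_improved` — the improved decay (constant
  `Ξ = e · 6√2 K · cumEnergyConst ε₀ C₃`).

## References

* T. Tao, arXiv:1402.0290v3, §6.4 Prop. 6.5 (6.49), (ix); §6.6 Prop. 6.13, (6.120)–(6.125).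
  [`Tao2016AveragedNS`]
-/

noncomputable section

open Set MeasureTheory intervalIntegral Filter Topology
open Literature.Analysis.ODE

namespace Literature.Analysis.FluidPDE

namespace TaoCascade

/-! ## Square root of a supersolution, variable rate -/

/-- **Square root of a supersolution, variable rate ("`∂ₜ√W` in a weak sense").** Let `W ≥ 0` be
continuous on `[a, b]` with right derivative `W'` on `[a, b)`, `α, κ ≥ 0` continuous on `[a, b]`,
and `W' ≤ 2 α √W + 2 κ W` on `[a, b)`. Then `√W(t) ≤ e^{∫_a^t κ} (√W(a) + ∫_a^t α)` for
`t ∈ [a, b]`. (Proof: `h = √(W+ι)` has `h' ≤ α + κ h`; variable-coefficient Grönwall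
`le_linearComparison`; let `ι ↓ 0`.) [folklore] -/
theorem sqrt_le_of_deriv_right_le_var {a b : ℝ} {W W' α κ : ℝ → ℝ}
    (hW : ContinuousOn W (Icc a b)) (hW' : ∀ t ∈ Ico a b, HasDerivWithinAt W (W' t) (Ici t) t)
    (hW0 : ∀ t ∈ Icc a b, 0 ≤ W t) (hα : ContinuousOn α (Icc a b)) (hα0 : ∀ t ∈ Icc a b, 0 ≤ α t)
    (hκ : ContinuousOn κ (Icc a b)) (hκ0 : ∀ t ∈ Icc a b, 0 ≤ κ t)
    (bound : ∀ t ∈ Ico a b, W' t ≤ 2 * α t * Real.sqrt (W t) + 2 * κ t * W t) {t : ℝ}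
    (ht : t ∈ Icc a b) :
    Real.sqrt (W t) ≤ Real.exp (∫ s in a..t, κ s) * (Real.sqrt (W a) + ∫ s in a..t, α s) := by
  have hint0 : 0 ≤ ∫ s in a..t, α s :=
    integral_nonneg ht.1 fun s hs => hα0 s ⟨hs.1, hs.2.trans ht.2⟩
  refine le_of_forall_pos_lt_add fun ι' hι' => ?_
  set E : ℝ := Real.exp (∫ s in a..t, κ s) with hE
  have hEpos : 0 < E := Real.exp_pos _
  set ι : ℝ := (ι' / (2 * E)) ^ 2 with hι
  have hιpos : 0 < ι := by positivity
  have hsqrtι : Real.sqrt ι = ι' / (2 * E) := by rw [hι, Real.sqrt_sq (by positivity)]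
  set h : ℝ → ℝ := fun s => Real.sqrt (W s + ι) with hh
  have hpos : ∀ s ∈ Icc a b, 0 < W s + ι := fun s hs => by linarith [hW0 s hs]
  have hhc : ContinuousOn h (Icc a b) := (hW.add continuousOn_const).sqrt
  have hh' : ∀ s ∈ Ico a b,
      HasDerivWithinAt h (W' s / (2 * Real.sqrt (W s + ι))) (Ici s) s := by
    intro s hs
    have := ((hW' s hs).add_const ι).sqrt (hpos s (Ico_subset_Icc_self hs)).ne'
    simpa using this
  have hbound : ∀ s ∈ Ico a b, W' s / (2 * Real.sqrt (W s + ι)) ≤ α s + κ s * h s := by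
    intro s hs
    have hs' := Ico_subset_Icc_self hs
    have hhs : 0 < Real.sqrt (W s + ι) := Real.sqrt_pos.2 (hpos s hs')
    have hWle : Real.sqrt (W s) ≤ Real.sqrt (W s + ι) := Real.sqrt_le_sqrt (by linarith)
    have hsq : W s ≤ Real.sqrt (W s + ι) ^ 2 := by
      rw [Real.sq_sqrt (hpos s hs').le]; linarith
    rw [div_le_iff₀ (by positivity)]
    have h1 := bound s hs
    have h2 : 2 * α s * Real.sqrt (W s) ≤ 2 * α s * Real.sqrt (W s + ι) :=
      mul_le_mul_of_nonneg_left hWle (by linarith [hα0 s hs'])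
    have h3 : 2 * κ s * W s ≤ 2 * κ s * Real.sqrt (W s + ι) ^ 2 :=
      mul_le_mul_of_nonneg_left hsq (by linarith [hκ0 s hs'])
    show W' s ≤ (α s + κ s * Real.sqrt (W s + ι)) * (2 * Real.sqrt (W s + ι))
    nlinarith
  have hcomp := le_linearComparison hhc hh' hα hκ hbound ht
  -- the weight `e^{-∫κ} ≤ 1`
  have hA : ∫ s in a..t, α s * Real.exp (-(∫ u in a..s, κ u)) ≤ ∫ s in a..t, α s := by
    have hαt : ContinuousOn α (Icc a t) := hα.mono (Icc_subset_Icc le_rfl ht.2)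
    have hκt : ContinuousOn κ (Icc a t) := hκ.mono (Icc_subset_Icc le_rfl ht.2)
    have hprim : ContinuousOn (fun s => ∫ u in a..s, κ u) (Icc a t) := by
      have h1 := intervalIntegral.continuousOn_primitive_interval' (μ := volume) (f := κ)
        (b₁ := a) (b₂ := t) (a := a) (hκt.intervalIntegrable_of_Icc ht.1) (by simp [ht.1])
      simpa [uIcc_of_le ht.1] using h1
    apply integral_mono_on ht.1
    · exact (hαt.mul hprim.neg.rexp).intervalIntegrable_of_Icc ht.1
    · exact hαt.intervalIntegrable_of_Icc ht.1
    · intro s hs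
      have hκs : Real.exp (-(∫ u in a..s, κ u)) ≤ 1 := by
        rw [Real.exp_le_one_iff, neg_nonpos]
        exact integral_nonneg hs.1 fun u hu => hκ0 u ⟨hu.1, hu.2.trans (hs.2.trans ht.2)⟩
      have := hα0 s ⟨hs.1, hs.2.trans ht.2⟩
      calc α s * Real.exp (-(∫ u in a..s, κ u)) ≤ α s * 1 :=
            mul_le_mul_of_nonneg_left hκs this
        _ = α s := mul_one _
  have hha : h a = Real.sqrt (W a + ι) := rfl
  have hWa : Real.sqrt (W a + ι) ≤ Real.sqrt (W a) + Real.sqrt ι :=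
    sqrt_add_le_sqrt_add_sqrt (hW0 a ⟨le_rfl, ht.1.trans ht.2⟩) hιpos.le
  calc Real.sqrt (W t) ≤ h t := Real.sqrt_le_sqrt (by linarith)
    _ ≤ E * (h a + ∫ s in a..t, α s * Real.exp (-(∫ u in a..s, κ u))) := hcomp
    _ ≤ E * (Real.sqrt (W a) + Real.sqrt ι + ∫ s in a..t, α s) := by
        rw [hha]; gcongr
    _ = E * (Real.sqrt (W a) + ∫ s in a..t, α s) + E * Real.sqrt ι := by ring
    _ < E * (Real.sqrt (W a) + ∫ s in a..t, α s) + ι' := by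
        rw [hsqrtι]; field_simp; nlinarith

/-! ## The rescaled past: locating a time in its interval `[τ_{k-1}, τ_k]` -/

section Past

variable {γ ε₀ K ε C₁ C₂ C₃ : ℝ} {n₀ N : ℤ} {τ : ℤ → ℝ} {Xr : Fin 4 → ℤ → ℝ → ℝ} {Er : ℤ → ℝ → ℝ}

/-- **Every past time lies in one of the intervals `[τ_{k-1}, τ_k]`**, `n₀-N < k ≤ 0`, provided the
past is nontrivial (`n₀ < N`). [cite: Tao2016AveragedNS, §6.4 Prop. 6.5 (vii)] -/
theorem RescaledHypotheses.exists_piece (h : RescaledHypotheses γ ε₀ K ε C₁ C₂ C₃ n₀ N τ Xr Er)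
    (hN : n₀ < N) {t : ℝ} (ht : t ∈ Icc (τ (n₀ - N)) 0) :
    ∃ k : ℤ, n₀ - N < k ∧ k ≤ 0 ∧ t ∈ Icc (τ (k - 1)) (τ k) := by
  -- the set of admissible `k` with `t ≤ τ k` contains `0`; take the least one
  classical
  have hP0 : t ≤ τ 0 := by rw [h.tau_zero]; exact ht.2
  -- induction on the number of steps from `n₀ - N`
  have key : ∀ n : ℕ, ∀ k : ℤ, k = n₀ - N + n → k ≤ 0 → t ≤ τ k → n₀ - N < k →
      ∃ j : ℤ, n₀ - N < j ∧ j ≤ 0 ∧ t ∈ Icc (τ (j - 1)) (τ j) := by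
    intro n
    induction n with
    | zero => intro k hk hk0 htk hlt; omega
    | succ n ih =>
      intro k hk hk0 htk hlt
      by_cases hcase : τ (k - 1) ≤ t
      · exact ⟨k, hlt, hk0, hcase, htk⟩
      · push Not at hcase
        rcases eq_or_lt_of_le (show n₀ - N ≤ k - 1 by omega) with heq | hlt'
        · -- `k - 1 = n₀ - N`: then `τ (k-1) = τ₀ ≤ t`, contradiction
          rw [← heq] at hcase
          exact absurd ht.1 (not_le.2 hcase)
        · exact ih (k - 1) (by omega) (by omega) hcase.le hlt'
  obtain ⟨n, hn⟩ : ∃ n : ℕ, (0 : ℤ) = n₀ - N + n := ⟨(N - n₀).toNat, by omega⟩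
  exact key n 0 hn le_rfl hP0 (by omega)

/-! ## `Ẽ₂` on the past -/

/-- `Ẽ₂^{1/2}` on the `k`-th past interval: from (ix) (`en_after` with `m = 2 - k`),
`Ẽ₂(t) ≤ K^{-30}(1+ε₀)^{-999/50 + (499/50)k}`, so `Ẽ₂(t)^{1/2} ≤ K^{-15}(1+ε₀)^{-999/100}(1+ε₀)^{(499/100)k}`.
[cite: Tao2016AveragedNS, §6.4 Prop. 6.5 (ix)] -/
theorem RescaledHypotheses.sqrt_energy_two_past_le
    (h : RescaledHypotheses γ ε₀ K ε C₁ C₂ C₃ n₀ N τ Xr Er) (hε₀ : 0 < ε₀) (hK : 0 < K)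
    {k : ℤ} (hk : n₀ - N < k) (hk0 : k ≤ 0) {t : ℝ} (ht : t ∈ Icc (τ (k - 1)) (τ k)) :
    Real.sqrt (Er 2 t) ≤ (K ^ 15)⁻¹ * (1 + ε₀) ^ (-(999 : ℝ) / 100) *
      (1 + ε₀) ^ (((248 : ℝ) / 100 + (251 : ℝ) / 100) * k) := by
  have h0 : (0 : ℝ) < 1 + ε₀ := by linarith
  obtain ⟨m', hm'⟩ : ∃ m' : ℕ, (m' : ℤ) = 2 - k := ⟨(2 - k).toNat, by omega⟩
  have hb := h.en_after' k hk hk0 t ht m' (by omega)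
  rw [show k + (m' : ℤ) = 2 by omega] at hb
  have hexp : -(10 : ℝ) * m' + (1 - k) / 50 = 2 * (-(999 : ℝ) / 100 +
      ((248 : ℝ) / 100 + (251 : ℝ) / 100) * k) := by
    have : (m' : ℝ) = 2 - (k : ℝ) := by exact_mod_cast hm'
    rw [this]; ring
  rw [hexp] at hb
  -- take square roots
  have hsq : (K ^ 30)⁻¹ * (1 + ε₀) ^ (2 * (-(999 : ℝ) / 100 + ((248 : ℝ) / 100 + (251 : ℝ) / 100) * k)) =
      ((K ^ 15)⁻¹ * (1 + ε₀) ^ (-(999 : ℝ) / 100) *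
        (1 + ε₀) ^ (((248 : ℝ) / 100 + (251 : ℝ) / 100) * k)) ^ 2 := by
    rw [mul_pow, mul_pow, ← Real.rpow_natCast ((1 + ε₀) ^ (-(999 : ℝ) / 100)) 2,
      ← Real.rpow_natCast ((1 + ε₀) ^ (((248 : ℝ) / 100 + (251 : ℝ) / 100) * k)) 2,
      ← Real.rpow_mul h0.le, ← Real.rpow_mul h0.le, mul_assoc ((K ^ 15)⁻¹ ^ 2),
      ← Real.rpow_add h0]
    congr 1
    · rw [inv_pow, ← pow_mul]
    · congr 1; push_cast; ring
  rw [hsq] at hb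
  have hnn : 0 ≤ (K ^ 15)⁻¹ * (1 + ε₀) ^ (-(999 : ℝ) / 100) *
      (1 + ε₀) ^ (((248 : ℝ) / 100 + (251 : ℝ) / 100) * k) := by positivity
  calc Real.sqrt (Er 2 t) ≤ Real.sqrt (((K ^ 15)⁻¹ * (1 + ε₀) ^ (-(999 : ℝ) / 100) *
        (1 + ε₀) ^ (((248 : ℝ) / 100 + (251 : ℝ) / 100) * k)) ^ 2) := Real.sqrt_le_sqrt hb
    _ = _ := Real.sqrt_sq hnn

/-- The cumulative `Ẽ₂^{1/2}` over the past:
`∫_{τ_{n₀-N}}^{τ_k} Ẽ₂^{1/2} ≤ K^{-15}(1+ε₀)^{-999/100} C₃ geomConst ε₀ (248/100) (1+ε₀)^{(248/100)k}`.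
[cite: Tao2016AveragedNS, §6.4 Lemma 6.7, §6.6 Prop. 6.13] -/
theorem RescaledHypotheses.integral_sqrt_energy_two_past_le
    (h : RescaledHypotheses γ ε₀ K ε C₁ C₂ C₃ n₀ N τ Xr Er) (hε₀ : 0 < ε₀) (hK : 0 < K)
    (hC₃ : 0 ≤ C₃) {k : ℤ} (hk1 : n₀ - N ≤ k) (hk2 : k ≤ 0) :
    ∫ t in (τ (n₀ - N))..(τ k), Real.sqrt (Er 2 t) ≤
      (K ^ 15)⁻¹ * (1 + ε₀) ^ (-(999 : ℝ) / 100) * C₃ * geomConst ε₀ ((248 : ℝ) / 100) *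
        (1 + ε₀) ^ ((248 : ℝ) / 100 * k) :=
  h.integral_past_le hε₀ hC₃ ((h.continuousOn_E 2 le_rfl).sqrt)
    (D := (K ^ 15)⁻¹ * (1 + ε₀) ^ (-(999 : ℝ) / 100)) (s := (248 : ℝ) / 100)
    (by have : (0 : ℝ) < 1 + ε₀ := by linarith
        positivity) (by norm_num)
    (fun k hk hk0 t ht => h.sqrt_energy_two_past_le hε₀ hK hk hk0 ht) hk1 hk2

/-! ## The local energy inequality at scale `1` as a supersolution inequality -/

/-- `x^{5/2} ≤ 6` for `0 ≤ x ≤ 2` (`2^{5/2} = 4√2 ≈ 5.66`): the bound used for `(1+ε₀)^{5/2}`.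
[folklore] -/
theorem rpow_five_halves_le_six {x : ℝ} (h0 : 0 ≤ x) (h2 : x ≤ 2) : x ^ ((5 : ℝ) / 2) ≤ 6 := by
  have hs2 : Real.sqrt 2 ≤ 3 / 2 := by
    rw [show (3 : ℝ) / 2 = Real.sqrt ((3 / 2) ^ 2) by rw [Real.sqrt_sq]; norm_num]
    exact Real.sqrt_le_sqrt (by norm_num)
  calc x ^ ((5 : ℝ) / 2) ≤ (2 : ℝ) ^ ((5 : ℝ) / 2) := Real.rpow_le_rpow h0 h2 (by norm_num)
    _ = (2 : ℝ) ^ ((2 : ℝ) + 1 / 2) := by norm_num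
    _ = (2 : ℝ) ^ (2 : ℝ) * (2 : ℝ) ^ ((1 : ℝ) / 2) := Real.rpow_add (by norm_num) _ _
    _ = 4 * Real.sqrt 2 := by
        rw [Real.sqrt_eq_rpow]; norm_num
    _ ≤ 4 * (3 / 2) := by linarith
    _ = 6 := by norm_num

/-- **(6.49) at scale `1`**: for `0 < ε₀ ≤ 1`, `K ≥ 0` and `t ≥ τ_{n₀-N}`,
`∂ₜẼ₁ ≤ 2 (6√2 K Ẽ₀) Ẽ₁^{1/2} + 2 (36√2 K Ẽ₂^{1/2}) Ẽ₁` (bound `d₀² ≤ 2Ẽ₀`, `a₁ ≤ (2Ẽ₁)^{1/2}`,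
`d₁² ≤ 2Ẽ₁`, `|a₂| ≤ (2Ẽ₂)^{1/2}`, `(1+ε₀)^{5/2} ≤ 6`). [cite: Tao2016AveragedNS, §6.4 Prop. 6.5 (6.49)] -/
theorem RescaledHypotheses.energy_one_deriv_le
    (h : RescaledHypotheses γ ε₀ K ε C₁ C₂ C₃ n₀ N τ Xr Er) (hε₀ : 0 < ε₀) (hε₀1 : ε₀ ≤ 1)
    (hK : 0 ≤ K) {t : ℝ} (ht : τ (n₀ - N) ≤ t) :
    derivWithin (Er 1) (Ici (τ (n₀ - N))) t ≤
      2 * (6 * Real.sqrt 2 * K * Er 0 t) * Real.sqrt (Er 1 t) +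
        2 * (36 * Real.sqrt 2 * K * Real.sqrt (Er 2 t)) * Er 1 t := by
  have h0 : (0 : ℝ) < 1 + ε₀ := by linarith
  have hq6 : (1 + ε₀) ^ ((5 : ℝ) / 2) ≤ 6 := rpow_five_halves_le_six h0.le (by linarith)
  have hq0 : 0 ≤ (1 + ε₀) ^ ((5 : ℝ) / 2) := (Real.rpow_pos_of_pos h0 _).le
  have hE := h.energy 1 t ht
  have hcast : (1 + ε₀) ^ ((5 : ℝ) * ((1 : ℤ) : ℝ) / 2) = (1 + ε₀) ^ ((5 : ℝ) / 2) := by norm_num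
  rw [hcast] at hE
  simp only [sub_self, Int.reduceAdd] at hE
  -- mode bounds
  have hd0 : Xr 3 0 t ^ 2 ≤ 2 * Er 0 t := h.sq_le_two_mul_energy 3 0 ht
  have ha1 : Xr 0 1 t ≤ Real.sqrt (2 * Er 1 t) := (le_abs_self _).trans (h.abs_le_sqrt_energy 0 1 ht)
  have hd1 : Xr 3 1 t ^ 2 ≤ 2 * Er 1 t := h.sq_le_two_mul_energy 3 1 ht
  have ha2 : |Xr 0 2 t| ≤ Real.sqrt (2 * Er 2 t) := h.abs_le_sqrt_energy 0 2 ht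
  have hE1 : 0 ≤ Er 1 t := h.nonneg_F 1 t ht
  have hE0 : 0 ≤ Er 0 t := h.nonneg_F 0 t ht
  have hE2 : 0 ≤ Er 2 t := h.nonneg_F 2 t ht
  have hs1 : Real.sqrt (2 * Er 1 t) = Real.sqrt 2 * Real.sqrt (Er 1 t) := Real.sqrt_mul (by norm_num) _
  have hs2 : Real.sqrt (2 * Er 2 t) = Real.sqrt 2 * Real.sqrt (Er 2 t) := Real.sqrt_mul (by norm_num) _
  have hsq1 : 0 ≤ Real.sqrt (Er 1 t) := Real.sqrt_nonneg _
  have hsq2 : 0 ≤ Real.sqrt (Er 2 t) := Real.sqrt_nonneg _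
  have hr2 : 0 ≤ Real.sqrt 2 := Real.sqrt_nonneg _
  -- term 1: `d₀² a₁ ≤ 2Ẽ₀ √2 √Ẽ₁`
  have hT1 : Xr 3 0 t ^ 2 * Xr 0 1 t ≤ 2 * Er 0 t * (Real.sqrt 2 * Real.sqrt (Er 1 t)) := by
    rw [← hs1]
    calc Xr 3 0 t ^ 2 * Xr 0 1 t ≤ Xr 3 0 t ^ 2 * Real.sqrt (2 * Er 1 t) :=
          mul_le_mul_of_nonneg_left ha1 (sq_nonneg _)
      _ ≤ 2 * Er 0 t * Real.sqrt (2 * Er 1 t) :=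
          mul_le_mul_of_nonneg_right hd0 (Real.sqrt_nonneg _)
  -- term 2: `-(1+ε₀)^{5/2} d₁² a₂ ≤ 6 · 2Ẽ₁ · √2 √Ẽ₂`
  have hT2 : -((1 + ε₀) ^ ((5 : ℝ) / 2) * Xr 3 1 t ^ 2 * Xr 0 2 t) ≤
      6 * (2 * Er 1 t) * (Real.sqrt 2 * Real.sqrt (Er 2 t)) := by
    rw [← hs2]
    have h1 : -((1 + ε₀) ^ ((5 : ℝ) / 2) * Xr 3 1 t ^ 2 * Xr 0 2 t) ≤
        (1 + ε₀) ^ ((5 : ℝ) / 2) * Xr 3 1 t ^ 2 * |Xr 0 2 t| := by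
      have : -(Xr 0 2 t) ≤ |Xr 0 2 t| := neg_le_abs _
      have hnn : 0 ≤ (1 + ε₀) ^ ((5 : ℝ) / 2) * Xr 3 1 t ^ 2 := by positivity
      nlinarith
    calc _ ≤ (1 + ε₀) ^ ((5 : ℝ) / 2) * Xr 3 1 t ^ 2 * |Xr 0 2 t| := h1
      _ ≤ 6 * (2 * Er 1 t) * Real.sqrt (2 * Er 2 t) := by
          apply mul_le_mul (mul_le_mul hq6 hd1 (sq_nonneg _) (by norm_num)) ha2 (abs_nonneg _)
          positivity
  have hK' : 0 ≤ K * (1 + ε₀) ^ ((5 : ℝ) / 2) := by positivity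
  calc derivWithin (Er 1) (Ici (τ (n₀ - N))) t
      ≤ K * (1 + ε₀) ^ ((5 : ℝ) / 2) *
          (Xr 3 0 t ^ 2 * Xr 0 1 t - (1 + ε₀) ^ ((5 : ℝ) / 2) * Xr 3 1 t ^ 2 * Xr 0 2 t) := hE
    _ ≤ K * (1 + ε₀) ^ ((5 : ℝ) / 2) * (2 * Er 0 t * (Real.sqrt 2 * Real.sqrt (Er 1 t)) +
          6 * (2 * Er 1 t) * (Real.sqrt 2 * Real.sqrt (Er 2 t))) := by
        apply mul_le_mul_of_nonneg_left _ hK'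
        linarith
    _ ≤ K * 6 * (2 * Er 0 t * (Real.sqrt 2 * Real.sqrt (Er 1 t)) +
          6 * (2 * Er 1 t) * (Real.sqrt 2 * Real.sqrt (Er 2 t))) := by
        apply mul_le_mul_of_nonneg_right (mul_le_mul_of_nonneg_left hq6 hK)
        positivity
    _ = _ := by ring

/-! ## Improved decay of `Ẽ₁` in the past -/

/-- **Improved past decay of `Ẽ₁`.** If `36√2 K · K^{-15}(1+ε₀)^{-999/100} C₃ geomConst ε₀ (248/100) ≤ 1`
(so that `∫ κ ≤ 1` over the past, a largeness condition on `K` in terms of `ε₀, C₃`), then on the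
`k`-th past interval, `n₀-N < k ≤ 0`, `τ_{k-1} ≤ t ≤ τ_k`:
`Ẽ₁(t)^{1/2} ≤ Ξ (1+ε₀)^{(747/100)k}` with `Ξ = e · 6√2 K · cumEnergyConst ε₀ C₃` — decay exponent
`747/100`, versus the `499/100` of `energy_one_past_le`. [cite: Tao2016AveragedNS, §6.4 Prop. 6.5 (6.49), §6.6 Prop. 6.13] -/
theorem RescaledHypotheses.sqrt_energy_one_past_le_improved
    (h : RescaledHypotheses γ ε₀ K ε C₁ C₂ C₃ n₀ N τ Xr Er) (hε₀ : 0 < ε₀) (hε₀1 : ε₀ < 1)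
    (hK : 1 ≤ K) (hC₃ : 0 ≤ C₃)
    (hκ : 36 * Real.sqrt 2 * K * ((K ^ 15)⁻¹ * (1 + ε₀) ^ (-(999 : ℝ) / 100) * C₃ *
      geomConst ε₀ ((248 : ℝ) / 100)) ≤ 1)
    {k : ℤ} (hk : n₀ - N < k) (hk0 : k ≤ 0) {t : ℝ} (ht : t ∈ Icc (τ (k - 1)) (τ k)) :
    Real.sqrt (Er 1 t) ≤ Real.exp 1 * (6 * Real.sqrt 2 * K) * cumEnergyConst ε₀ C₃ *
      (1 + ε₀) ^ ((747 : ℝ) / 100 * k) := by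
  have h0 : (0 : ℝ) < 1 + ε₀ := by linarith
  have hKpos : 0 < K := by linarith
  set T₀ := τ (n₀ - N) with hT₀
  have hτt : T₀ ≤ t := (h.tau_init_le_tau (by omega) (by omega)).trans ht.1
  have htk : t ≤ τ k := ht.2
  have hk0' : τ k ≤ 0 := h.tau_le k (by omega) hk0
  have ht0 : t ≤ 0 := htk.trans hk0'
  -- the supersolution inequality on `[T₀, 0]`
  set α : ℝ → ℝ := fun s => 6 * Real.sqrt 2 * K * Er 0 s with hα
  set κ : ℝ → ℝ := fun s => 36 * Real.sqrt 2 * K * Real.sqrt (Er 2 s) with hκdef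
  have hαc : ContinuousOn α (Icc T₀ 0) := continuousOn_const.mul (h.continuousOn_E 0 le_rfl)
  have hκc : ContinuousOn κ (Icc T₀ 0) := continuousOn_const.mul (h.continuousOn_E 2 le_rfl).sqrt
  have hα0 : ∀ s ∈ Icc T₀ 0, 0 ≤ α s := fun s hs => by
    simp only [hα]; have := h.nonneg_F 0 s hs.1; positivity
  have hκ0 : ∀ s ∈ Icc T₀ 0, 0 ≤ κ s := fun s hs => by simp only [hκdef]; positivity
  have hmain := sqrt_le_of_deriv_right_le_var (h.continuousOn_E 1 le_rfl)
    (fun s hs => h.hasDeriv_E 1 hs.1) (fun s hs => h.nonneg_F 1 s hs.1) hαc hα0 hκc hκ0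
    (fun s hs => h.energy_one_deriv_le hε₀ hε₀1.le hKpos.le hs.1) (t := t) ⟨hτt, ht0⟩
  -- `Ẽ₁(T₀) = 0`
  have hinit : Er 1 T₀ = 0 := h.init_F 1 (by omega)
  rw [hinit, Real.sqrt_zero, zero_add] at hmain
  -- `∫_{T₀}^t κ ≤ ∫_{T₀}^0 κ ≤ 1`
  have hκi : ∀ {x y : ℝ}, T₀ ≤ x → x ≤ y → y ≤ 0 → IntervalIntegrable κ volume x y :=
    fun hx hxy hy => (hκc.mono (Icc_subset_Icc hx hy)).intervalIntegrable_of_Icc hxy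
  have hκint : ∫ s in T₀..t, κ s ≤ 1 := by
    have h1 : ∫ s in T₀..t, κ s ≤ ∫ s in T₀..(0 : ℝ), κ s := by
      apply integral_mono_interval le_rfl hτt ht0
      · exact Filter.Eventually.of_forall fun s => by simp only [hκdef]; positivity
      · exact hκi le_rfl (hτt.trans ht0) le_rfl
    have h2 : ∫ s in T₀..(0 : ℝ), κ s = 36 * Real.sqrt 2 * K * ∫ s in T₀..(0 : ℝ), Real.sqrt (Er 2 s) := by
      simp only [hκdef]; exact intervalIntegral.integral_const_mul _ _
    have h3 := h.integral_sqrt_energy_two_past_le hε₀ hKpos hC₃ (k := 0) (by omega) le_rfl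
    rw [h.tau_zero] at h3
    simp only [Int.cast_zero, mul_zero, Real.rpow_zero, mul_one] at h3
    have h4 : 36 * Real.sqrt 2 * K * ∫ s in T₀..(0 : ℝ), Real.sqrt (Er 2 s) ≤ 1 :=
      (mul_le_mul_of_nonneg_left h3 (by positivity)).trans hκ
    linarith
  -- `∫_{T₀}^t α ≤ 6√2 K · cumEnergyConst · q^{(747/100) k}`
  have hαint : ∫ s in T₀..t, α s ≤
      6 * Real.sqrt 2 * K * (cumEnergyConst ε₀ C₃ * (1 + ε₀) ^ ((747 : ℝ) / 100 * k)) := by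
    have hτk : T₀ ≤ τ k := h.tau_init_le_tau (by omega) hk0
    have h1 : ∫ s in T₀..t, α s ≤ ∫ s in T₀..(τ k), α s := by
      apply integral_mono_interval le_rfl hτt htk
      · exact ae_restrict_of_forall_mem measurableSet_Ioc fun s hs => by
          simp only [hα]
          have := h.nonneg_F 0 s hs.1.le; positivity
      · exact (hαc.mono (Icc_subset_Icc le_rfl hk0')).intervalIntegrable_of_Icc hτk
    have h2 : ∫ s in T₀..(τ k), α s = 6 * Real.sqrt 2 * K * ∫ s in T₀..(τ k), Er 0 s := by
      simp only [hα]; exact intervalIntegral.integral_const_mul _ _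
    have h3 := h.integral_energy_past_le hε₀ hε₀1 hK hC₃ (m := 0) (Or.inr (Or.inl rfl))
      (k := k) (by omega) hk0
    calc ∫ s in T₀..t, α s ≤ 6 * Real.sqrt 2 * K * ∫ s in T₀..(τ k), Er 0 s := by rw [← h2]; exact h1
      _ ≤ _ := mul_le_mul_of_nonneg_left h3 (by positivity)
  have hexp : Real.exp (∫ s in T₀..t, κ s) ≤ Real.exp 1 := Real.exp_le_exp.2 hκint
  have hαnn : 0 ≤ ∫ s in T₀..t, α s := integral_nonneg hτt fun s hs => hα0 s ⟨hs.1, hs.2.trans ht0⟩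
  calc Real.sqrt (Er 1 t) ≤ Real.exp (∫ s in T₀..t, κ s) * ∫ s in T₀..t, α s := hmain
    _ ≤ Real.exp 1 * (6 * Real.sqrt 2 * K * (cumEnergyConst ε₀ C₃ * (1 + ε₀) ^ ((747 : ℝ) / 100 * k))) :=
        mul_le_mul hexp hαint hαnn (Real.exp_pos _).le
    _ = _ := by ring

end Past

end TaoCascade

end Literature.Analysis.FluidPDE
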